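import Literature.MathematicalPhysics.QuantumFieldTheory.Balaban1983to89.B9LettersZCFieldsAtPins
import Literature.MathematicalPhysics.QuantumFieldTheory.Balaban1983to89.B9BackgroundsKLevelV1R
import Literature.MathematicalPhysics.QuantumFieldTheory.Balaban1983to89.Node00.OpsYRecordV4P

/-!
# BalabanUVNodes ∕ N06 ([B9], `Dag.B9_main`) — THE DISPLAYED BLOCK-L² LETTER `hLL2`.1.c1 (C₁ = (QG₁Q\*)⁻¹ in block L²) OF THE STAGE-11 CERTIFICATE AT THE PINS,
# POINTWISE-GUARD EDITION «Pt» of dag-n06-c's `…N06C1L2LegAtPinsR.c1L2_of_pinsR` (node00-def-Y ⚑ LOCATED-30 «KD-KNIT-GUARD» (F2), bus I.20668): the residual datum's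
# symmetry enters at the ONE regular configuration in hand, `hΔ2U : IsSymmTr 1 (Δ2 x U)`, instead of the unguarded family `∀ x U, U SU(N)-valued → IsSymmTr 1 (Δ2 x U)`

Track A of `YM-PLAN.md` (cell `pub-ymgap`, HUMAN RULING D-0062), node **N06** = [Balaban1985BackgroundPropagators] Thms 3.1–3.15; rows 20–21; seat `pub-ymgap-dag-n06-l`
(g39), a HELPER for dag-n06-d's knit certificate guard edition KD′.  WHY.  dag-n06-c's landed `c1L2_of_pinsR` (its module text applies word for word to everything not
listed here) displays `hΔ2 : ∀ x U, (∀ μ z, U μ z ∈ SU(N)) → IsSymmTr 1 (Δ2 x U)` and uses it ONCE, at the regular `U` of its own statement (`hΔ2 x U hUG`).  At the KNIT record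
the residual `Δ⁽²⁾` is `resYOfRecordPK` (built from the record's own knit `H`, (3.134)), whose reality is (3.35)-KEYED in the tree (`OpsYDelta2FormQ.resYOfRecordPK_Δ2_isSymmTr_SU_threshK`);
node00-def-Y's census (⚑ LOCATED-30): no unguarded inhabitant exists or is expected (ruling (α): every analytic ∕ structural law of the knit letters is (3.35)-keyed), so KD's
displayed unguarded `hΔ2` — forwarded to `c1L2_of_pinsR` — cannot be closed at the knit record.  THE FIX (def-Y's (F2), mechanical): THIS FILE re-types the lemma with the
POINTWISE binder `(hΔ2U : IsSymmTr (fun _ => (1 : ℝ)) (Δ2 x U))` at the statement's own `(x, U)`; proof otherwise IDENTICAL (Schur `c1_l2_of_c1_2` + `isTransposePair_C1coK` +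
def-Y's `G1Y_GpPhysY_isSymmTr_parSymY`).  BINDER LEDGER vs the parent: GONE 1 (`hΔ2` family), NEW 1 (`hΔ2U` pointwise, placed after `hU`); everything else IDENTICAL (theorem
`c1L2_of_pinsR_pt`; the parent stays in tree untouched and is the instance `hΔ2U := hΔ2 x U (mem_of_reg335R hGR x hU)` of this one; not restated here — the parent IS that statement).
CONSUMER: KD′ applies it at its regular `U` with `hΔ2U := hΔ2′ x hM α₀ hα ha U hU` from a GUARDED display `hΔ2′` (KD's `hsymT` shape), which KC′ closes by def-Y's
`resYOfRecordPK_Δ2_isSymmTr_SU_threshK` + `hRP1`.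
HONEST LABEL: kernel bookkeeping; helper, count-neutral; N06 NOT discharged by this file; nothing continuum ∕ OS ∕ mass gap ∕ Clay.  NEW sibling basename (a landed statement is
never edited in place); 1 thm, 0 def, no sorry.
[cite: Balaban1985BackgroundPropagators, (3.132) p.422, Thm 3.13 p.426, (3.46) p.398, (3.128)–(3.129) p.421, (3.134) p.422, Thm 3.11 p.416, (3.35) p.396; Balaban1984PropagatorsII, (2.51) p.232]
-/

noncomputable section

namespace Summit.QuantumFields.YangMills.BalabanUVNodes.N06C1L2LegAtPinsRPt

open scoped Matrix.Norms.L2Operator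
open Literature.MathematicalPhysics.QuantumFieldTheory.Balaban1983to89
open Literature.MathematicalPhysics.QuantumFieldTheory.Balaban1983to89.Node00
open Literature.MathematicalPhysics.QuantumFieldTheory.Balaban1983to89.B9PinMembersKLevelV1 (MemberY geo9Y)
open Literature.MathematicalPhysics.QuantumFieldTheory.Balaban1983to89.B9BackgroundsKLevelV1R (RegFamY bg9YR MemOfFam mem_of_reg335R)
open Literature.MathematicalPhysics.QuantumFieldTheory.Balaban1983to89.B7Prop2SpecialUnitary (specialUnitaryUnits specialUnitaryUnits_le_unitaryUnits)
open Literature.MathematicalPhysics.QuantumFieldTheory.Balaban1983to89.B6Ineq2142KLevelV1 (lvl)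
open Literature.MathematicalPhysics.QuantumFieldTheory.Balaban1983to89.B9CoReadingCoordsTranspose (TrIdx trBasis)
open Literature.MathematicalPhysics.QuantumFieldTheory.Balaban1983to89.B9CoReadingCoords (XBK)
open Literature.MathematicalPhysics.QuantumFieldTheory.Balaban1983to89.B9CoReadingCoordsH (XHK)
open Literature.MathematicalPhysics.QuantumFieldTheory.Balaban1983to89.B9GeoNormsKLevelV1 (geo9K geo9K_dist_nonneg)
open Literature.MathematicalPhysics.QuantumFieldTheory.Balaban1983to89.B9GeoLemma21KLevelV1 (geo9Y_dist_triangle geo9Y_dist_comm geo9Y_len_pos)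
open Literature.MathematicalPhysics.QuantumFieldTheory.Balaban1983to89.B9Thm34Ext (toB6)
open Literature.MathematicalPhysics.QuantumFieldTheory.Balaban1983to89.B9SectDSup (weightNorm)
open Literature.MathematicalPhysics.QuantumFieldTheory.Balaban1983to89.B9SectDL2Decay (BlockBd)
open Literature.MathematicalPhysics.QuantumFieldTheory.Balaban1983to89.B11SectG (HasMaj BlockNorm)
open Literature.MathematicalPhysics.QuantumFieldTheory.Balaban1983to89.B9Thm312Whole (Ops GeoOK cNorm)
open Literature.MathematicalPhysics.QuantumFieldTheory.Balaban1983to89.B9Thm37Glue (IsTransposePair)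
open Literature.MathematicalPhysics.QuantumFieldTheory.Balaban1983to89.B9Thm311ReadingCoords (IsSymmTr)
open Literature.MathematicalPhysics.QuantumFieldTheory.Balaban1983to89.Node00.OpsYSectDCoords (C1coK)
open Literature.MathematicalPhysics.QuantumFieldTheory.Balaban1983to89.B9LettersZCFieldsAtPins (c1_l2_of_c1_2 isTransposePair_C1coK)

variable {N : ℕ}

/-- ★★ **`hLL2`.1.c1 AT THE PINS, EVERY MEMBER, EVERY REGULAR `U` — POINTWISE-GUARD EDITION «Pt» (the residual datum symmetric AT THIS `U`: `hΔ2U`)** (module docstring): at a record `𝔬12 x` whose letter `C1` is pinned to node00-def-Y's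
`C1coK … (parSymY) (parBY) (GpPhysY (parSymY)) (Δ2 x)` (`hC1co12`), for an SU(N)-valued configuration (read off `hGR` and `Reg335`) with a trace-symmetric residual
datum AT THIS configuration (`hΔ2U`), the DERIVED (3.132) class letter `HasMaj 𝔠_Z⁽²⁾ Z_{n⁻¹} (C₁(U)) (B·e^{−δd})` (`zletters_of_pins`, conjunct 5) gives the block-L² field
‖1_{Δ(y)}C₁μ‖₂ ≦ B·(√(n(y)⁻¹)·Lʲη)⁻¹·(√(n(y′)⁻¹)·L^{j′}η)⁻¹·e^{−δd(y,y′)}‖μ‖₂ — `Letters313L2Pk.c1`'s statement at the SAME `(B, δ)`, any block map `blkZ`.  Inside: dag-n06-w5's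
`c1_l2_of_c1_2` (Schur) and `isTransposePair_C1coK`, def-Y's `G1Y_GpPhysY_isSymmTr_parSymY`.
[cite: Balaban1985BackgroundPropagators, (3.132) p.422, Thm 3.13 p.426 + (3.46) p.398 + p.391 (the L² adjoints), (3.128)–(3.129) p.421, Thm 3.11 p.416; Balaban1984PropagatorsII, (2.51) p.232] -/
theorem c1L2_of_pinsR_pt {θ : Stage3Params} {Mstar : ℕ} {R₁ R₂ : RegFamY θ.d₆ θ.ℓ₆ θ.hd' θ.hL' θ.b₀ θ.b₁ Mstar (Matrix (Fin N) (Fin N) ℂ)} {c : ℝ}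
    (hGR : MemOfFam (specialUnitaryUnits (Fin N)) R₁)
    [∀ x : MemberY θ.d₆ θ.ℓ₆ θ.hd' θ.hL' θ.b₀ θ.b₁ Mstar, Fintype (geo9Y x).Site]
    {H12 : MemberY θ.d₆ θ.ℓ₆ θ.hd' θ.hL' θ.b₀ θ.b₁ Mstar → Prop}
    {X12 Y12 W12 : MemberY θ.d₆ θ.ℓ₆ θ.hd' θ.hL' θ.b₀ θ.b₁ Mstar → Type} [∀ x, Fintype (X12 x)] [∀ x, Fintype (Y12 x)] [∀ x, Fintype (W12 x)]
    (𝔬12 : ∀ x : MemberY θ.d₆ θ.ℓ₆ θ.hd' θ.hL' θ.b₀ θ.b₁ Mstar, B9Thm312Whole.Ops (geo9Y x) (bg9YR (Matrix (Fin N) (Fin N) ℂ) (specialUnitaryUnits (Fin N)) R₁ R₂ x) (X12 x) (Y12 x) (XHK (TrIdx N) x.toKIdx) (W12 x))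
    (Δ2 : ∀ x : MemberY θ.d₆ θ.ℓ₆ θ.hd' θ.hL' θ.b₀ θ.b₁ Mstar, BondOpY (Matrix (Fin N) (Fin N) ℂ) x.toKIdx)
    (hC1co12 : ∀ (x : MemberY θ.d₆ θ.ℓ₆ θ.hd' θ.hL' θ.b₀ θ.b₁ Mstar) (U : (bg9YR (Matrix (Fin N) (Fin N) ℂ) (specialUnitaryUnits (Fin N)) R₁ R₂ x).Cfg),
      (𝔬12 x).C1 U = C1coK x.toKIdx (trBasis N) (bg9YR (Matrix (Fin N) (Fin N) ℂ) (specialUnitaryUnits (Fin N)) R₁ R₂ x) (fun U => U)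
        (parSymY x.toKIdx) (parBY x.toKIdx) (GpPhysY x.toKIdx (parSymY x.toKIdx)) (Δ2 x) U)
    (x : MemberY θ.d₆ θ.ℓ₆ θ.hd' θ.hL' θ.b₀ θ.b₁ Mstar) {α₀ : ℝ} (U : (bg9YR (Matrix (Fin N) (Fin N) ℂ) (specialUnitaryUnits (Fin N)) R₁ R₂ x).Cfg)
    (hU : (bg9YR (Matrix (Fin N) (Fin N) ℂ) (specialUnitaryUnits (Fin N)) R₁ R₂ x).Reg335 c α₀ U)
    (hΔ2U : IsSymmTr (fun _ => (1 : ℝ)) (Δ2 x U))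
    {B δ : ℝ} (hB : 0 ≤ B)
    (hpl : ∀ y : (geo9Y x).Site, 0 ≤ ((((θ.ℓ₆ + 1 : ℕ) : ℝ) ^ (θ.d₆ + 1)) ^ lvl x.hN x.D x.hk y)⁻¹)
    (hc12 : HasMaj (cNorm 1 (H12 x) (𝔬12 x).blkZ (fun y => (geo9Y_len_pos x y).le) 2)
      (weightNorm (BlockNorm.ofBlocks (toB6 (geo9Y x) 1 (H12 x)) (𝔬12 x).blkZ) (fun y => ((((θ.ℓ₆ + 1 : ℕ) : ℝ) ^ (θ.d₆ + 1)) ^ lvl x.hN x.D x.hk y)⁻¹) hpl)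
      ((𝔬12 x).C1 U) (fun a b => B * Real.exp (-(δ * (geo9Y x).dist a b)))) :
    BlockBd (g := toB6 (geo9Y x) 1 (H12 x)) (𝔬12 x).blkZ (𝔬12 x).blkZ ((𝔬12 x).C1 U)
      (fun (y y' : (geo9Y x).Site) => B * (Real.sqrt ((((θ.ℓ₆ + 1 : ℕ) : ℝ) ^ (θ.d₆ + 1)) ^ lvl x.hN x.D x.hk y)⁻¹ * (geo9Y x).len y)⁻¹ *
        (Real.sqrt ((((θ.ℓ₆ + 1 : ℕ) : ℝ) ^ (θ.d₆ + 1)) ^ lvl x.hN x.D x.hk y')⁻¹ * (geo9Y x).len y')⁻¹ * Real.exp (-(δ * (geo9Y x).dist y y'))) := by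
  letI : Fintype (geo9K x.toKIdx).Site := (inferInstance : Fintype (geo9Y x).Site)
  have hG : GeoOK (geo9Y x) := ⟨geo9Y_dist_triangle x, geo9Y_dist_comm x, geo9K_dist_nonneg x.toKIdx, geo9Y_len_pos x⟩
  have hUG : ∀ μ z, U μ z ∈ specialUnitaryUnits (Fin N) := fun μ z => mem_of_reg335R hGR x hU μ z
  have hplp : ∀ y : (geo9Y x).Site, 0 < ((((θ.ℓ₆ + 1 : ℕ) : ℝ) ^ (θ.d₆ + 1)) ^ lvl x.hN x.D x.hk y)⁻¹ := fun y => by positivity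
  -- G₁(U) is trace-symmetric at the symmetrised tables for a symmetric residual datum (node00-def-Y)
  have hG1 : IsSymmTr (fun _ => (1 : ℝ)) (G1Y x.toKIdx (parSymY x.toKIdx) (parBY x.toKIdx) (GpPhysY x.toKIdx (parSymY x.toKIdx)) (Δ2 x) U) :=
    G1Y_GpPhysY_isSymmTr_parSymY x.toKIdx (specialUnitaryUnits_le_unitaryUnits (n := Fin N)) hUG (Δ2 x) hΔ2U
  -- C₁'s model is its own counting-transpose (dag-n06-w5)
  have hT' := isTransposePair_C1coK x.toKIdx (bg9YR (Matrix (Fin N) (Fin N) ℂ) (specialUnitaryUnits (Fin N)) R₁ R₂ x) (fun U => U)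
    (parSymY x.toKIdx) (GpPhysY x.toKIdx (parSymY x.toKIdx)) (Δ2 x) (specialUnitaryUnits_le_unitaryUnits (n := Fin N)) U hUG hG1
  have hT : IsTransposePair ((𝔬12 x).C1 U) ((𝔬12 x).C1 U) := by rw [hC1co12 x U]; exact hT'
  -- Schur (dag-n06-w5's `c1_l2_of_c1_2`)
  exact c1_l2_of_c1_2 (R₀ := (1 : ℝ)) (H₀ := H12 x) hG hB hplp hc12 hT

end Summit.QuantumFields.YangMills.BalabanUVNodes.N06C1L2LegAtPinsRPt

end
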